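import Mathlib
import HarnessLib
import Summits.ValiantsHypothesis.ValiantsHypothesis.Theorems.LacunarySymmetroidMatrixDescartesProductPlusOneRowTowerKTwoLetter
import Summits.ValiantsHypothesis.ValiantsHypothesis.Theorems.LacunarySymmetroidMatrixDescartesProductPlusOneSlowKneeCellEveryK

/-!
# LINE (A) `product_plus_one` — the every-K θ-shell as an ENGINE on per-row laws, and the ROW LAWS of the three menu classes

Refactoring companion of ✓ `…SlowKneeCellEveryK` (support `d : Fin (n+2) → ℕ`, `StrictMono d`, base rate `p = d 1 − d 0`, rows `f_j = Σ_l C (a j l) X^{d l}`,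
stripped rows `a_{j0} − Σ_l (−a_{j,l+1}) x^{d_{l+1} − d_0}`, tower ✓ `rowPsiK1/3`):

* §1 ★ `wronskianK_no_three_zeros_of_rowLaws` / ★ `wronskianK_roots_le_two_of_rowLaws` — if on `(u,v)` (`0 < u`) every row's stripped form is non-zero and obeys
  the STRICT rate law `p²·ψ₁ < ψ₃`, then `W(∏_j f_j)` has no three roots / at most two roots in `(u,v)` (✓ `no_three_zeros_of_theta_sq_law` +
  ✓ `logWronskian_prodK_eq_rowPsiK1_sum`) — the cell theorems become one-line corollaries of ROW LAWS;
* §2 the row laws («non-vanishing ∧ `p²ψ₁ < ψ₃` on the window») of the menu classes: `rowLaws_single` (binomial on `(d₀, d_{l₀+1})`: any signs on the slow pair,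
  pole otherwise; root outside), `rowLaws_cloud` (unswitched incoherent K-nomial), and the NEW `rowLaws_pair` (binomial on a pair `(d_{i+1}, d_{j+1})` of
  non-bottom letters, `i < j`: POLE `a_i a_j < 0` when `d_{j+1} − d_{i+1} ≥ p`, KNEE `a_i a_j > 0` when `d_{j+1} − d_{i+1} ≤ p`; ✓ `rowPsiK3_pair_law`).

Honest framing: engine + row lemmas for W-cells (helpers); nothing closes a stub; `OneChangeFloorK3` / `WronskianBudgetK3` / 18050 / `MatrixDescartes` OPEN;
`VP ≠ VNP` NOT proved.  No definitions, no named facts.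
-/

set_option linter.dupNamespace false

namespace Summit.ValiantsHypothesis.ValiantsHypothesis.Theorems.LacunarySymmetroidMatrixDescartes

namespace ProductPlusOne

open Finset Set Polynomial
open scoped BigOperators Topology Polynomial

/-! ### §1 The engine on row laws -/

/-- ★ **ENGINE**: per-row laws («stripped row `≠ 0` and `p²ψ₁ < ψ₃` on the window», `p = d 1 − d 0`) ⇒ `W(∏_j f_j)` has no three roots in `(u,v)` (`0 < m`).
[this file's theorem] -/
theorem wronskianK_no_three_zeros_of_rowLaws {m n : ℕ} (hm : 0 < m) (d : Fin (n + 2) → ℕ) (hd : StrictMono d)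
    (a : Fin m → Fin (n + 2) → ℝ) {u v : ℝ} (hu : 0 < u)
    (hlaws : ∀ j, ∀ x ∈ Ioo u v,
      a j 0 - ∑ l : Fin (n + 1), (-(a j l.succ)) * x ^ (d l.succ - d 0) ≠ 0 ∧
      ((d 1 - d 0 : ℕ) : ℝ) ^ 2 * rowPsiK1 (fun l : Fin (n + 1) => d l.succ - d 0) (a j 0) (fun l : Fin (n + 1) => -(a j l.succ)) x
        < rowPsiK3 (fun l : Fin (n + 1) => d l.succ - d 0) (a j 0) (fun l : Fin (n + 1) => -(a j l.succ)) x)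
    {x₁ x₂ x₃ : ℝ} (h₁ : x₁ ∈ Ioo u v) (h₃ : x₃ ∈ Ioo u v) (h12' : x₁ < x₂) (h23 : x₂ < x₃)
    (hzero : ∀ x ∈ ({x₁, x₂, x₃} : Set ℝ),
      ((∏ j, ∑ l, C (a j l) * X ^ (d l) : ℝ[X]) * (X * derivative (X * derivative (∏ j, ∑ l, C (a j l) * X ^ (d l) : ℝ[X])))
        - (X * derivative (∏ j, ∑ l, C (a j l) * X ^ (d l) : ℝ[X])) ^ 2).eval x = 0) : False := by
  classical
  have hd0 : ∀ l, d 0 ≤ d l := fun l => hd.monotone (Fin.zero_le l)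
  have hp1 : 1 ≤ d 1 - d 0 := by
    have := hd (show (0 : Fin (n + 2)) < 1 from Fin.zero_lt_one)
    omega
  have hcast : (((d 1 - d 0 - 1 : ℕ) : ℝ) + 1) = ((d 1 - d 0 : ℕ) : ℝ) := by
    have h : d 1 - d 0 - 1 + 1 = d 1 - d 0 := Nat.sub_add_cancel hp1
    exact_mod_cast congrArg (fun k : ℕ => (k : ℝ)) h
  have h₂ : x₂ ∈ Ioo u v := ⟨h₁.1.trans h12', h23.trans h₃.2⟩
  have hIoo : ∀ x ∈ ({x₁, x₂, x₃} : Set ℝ), x ∈ Ioo u v := by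
    intro x hx
    simp only [Set.mem_insert_iff, Set.mem_singleton_iff] at hx
    rcases hx with h | h | h <;> subst h <;> assumption
  have hev : ∀ j x, (∑ l, C (a j l) * X ^ (d l) : ℝ[X]).eval x
      = x ^ (d 0) * (a j 0 - ∑ l : Fin (n + 1), (-(a j l.succ)) * x ^ (d l.succ - d 0)) := fun j x => eval_rowK_eq d hd0 (a j) x
  have hf : ∀ x ∈ Ioo u v, ∀ j, (∑ l, C (a j l) * X ^ (d l) : ℝ[X]).eval x ≠ 0 := by
    intro x hx j
    rw [hev]
    exact mul_ne_zero (pow_ne_zero _ (hu.trans hx.1).ne') (hlaws j x hx).1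
  have hsum : ∀ x ∈ ({x₁, x₂, x₃} : Set ℝ),
      ∑ j, rowPsiK1 (fun l : Fin (n + 1) => d l.succ - d 0) (a j 0) (fun l : Fin (n + 1) => -(a j l.succ)) x = 0 := by
    intro x hx
    have hxI := hIoo x hx
    have hx0 : 0 < x := hu.trans hxI.1
    have h := hzero x hx
    rw [logWronskian_prodK_eq_rowPsiK1_sum d hd0 a hx0 (hf x hxI)] at h
    have hP : ((∏ j, (∑ l, C (a j l) * X ^ (d l) : ℝ[X])).eval x) ≠ 0 := by
      rw [eval_prod]; exact Finset.prod_ne_zero_iff.2 fun j _ => hf x hxI j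
    rcases mul_eq_zero.1 h with h1 | h1
    · exact absurd (neg_eq_zero.1 h1) (pow_ne_zero 2 hP)
    · exact h1
  refine no_three_zeros_of_theta_sq_law (d 1 - d 0 - 1) hu.le
    (S := fun x => ∑ j, rowPsiK1 (fun l : Fin (n + 1) => d l.succ - d 0) (a j 0) (fun l : Fin (n + 1) => -(a j l.succ)) x)
    (S₁ := fun x => ∑ j, rowPsiK2 (fun l : Fin (n + 1) => d l.succ - d 0) (a j 0) (fun l : Fin (n + 1) => -(a j l.succ)) x)
    (S₂ := fun x => ∑ j, rowPsiK3 (fun l : Fin (n + 1) => d l.succ - d 0) (a j 0) (fun l : Fin (n + 1) => -(a j l.succ)) x)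
    ?_ ?_ ?_ h₁ h₃ h12' h23 (hsum x₁ (by simp)) (hsum x₂ (by simp)) (hsum x₃ (by simp))
  · intro x hx
    have hx0 : x ≠ 0 := (hu.trans hx.1).ne'
    have h := HasDerivAt.fun_sum (u := Finset.univ)
      (fun j _ => hasDerivAt_rowPsiK1 (fun l : Fin (n + 1) => d l.succ - d 0) (a j 0) (fun l : Fin (n + 1) => -(a j l.succ)) hx0
        (hlaws j x hx).1)
    simpa only [Finset.sum_div] using h
  · intro x hx
    have hx0 : x ≠ 0 := (hu.trans hx.1).ne'
    have h := HasDerivAt.fun_sum (u := Finset.univ)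
      (fun j _ => hasDerivAt_rowPsiK2 (fun l : Fin (n + 1) => d l.succ - d 0) (a j 0) (fun l : Fin (n + 1) => -(a j l.succ)) hx0
        (hlaws j x hx).1)
    simpa only [Finset.sum_div] using h
  · intro x hx
    rw [hcast, Finset.mul_sum]
    exact Finset.sum_lt_sum (fun j _ => (hlaws j x hx).2.le) ⟨⟨0, hm⟩, Finset.mem_univ _, (hlaws _ x hx).2⟩

/-- ★ **ENGINE, counting form**: per-row laws on `(u,v)` ⇒ `W(∏_j f_j)` has AT MOST TWO roots in `(u,v)` (any `m`). [this file's theorem] -/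
theorem wronskianK_roots_le_two_of_rowLaws {m n : ℕ} (d : Fin (n + 2) → ℕ) (hd : StrictMono d)
    (a : Fin m → Fin (n + 2) → ℝ) {u v : ℝ} (hu : 0 < u)
    (hlaws : ∀ j, ∀ x ∈ Ioo u v,
      a j 0 - ∑ l : Fin (n + 1), (-(a j l.succ)) * x ^ (d l.succ - d 0) ≠ 0 ∧
      ((d 1 - d 0 : ℕ) : ℝ) ^ 2 * rowPsiK1 (fun l : Fin (n + 1) => d l.succ - d 0) (a j 0) (fun l : Fin (n + 1) => -(a j l.succ)) x
        < rowPsiK3 (fun l : Fin (n + 1) => d l.succ - d 0) (a j 0) (fun l : Fin (n + 1) => -(a j l.succ)) x) :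
    (((∏ j, ∑ l, C (a j l) * X ^ (d l) : ℝ[X]) * (X * derivative (X * derivative (∏ j, ∑ l, C (a j l) * X ^ (d l) : ℝ[X])))
        - (X * derivative (∏ j, ∑ l, C (a j l) * X ^ (d l) : ℝ[X])) ^ 2).roots.toFinset.filter (fun t => u < t ∧ t < v)).card ≤ 2 := by
  classical
  set W : ℝ[X] := (∏ j, ∑ l, C (a j l) * X ^ (d l) : ℝ[X]) * (X * derivative (X * derivative (∏ j, ∑ l, C (a j l) * X ^ (d l) : ℝ[X])))
      - (X * derivative (∏ j, ∑ l, C (a j l) * X ^ (d l) : ℝ[X])) ^ 2 with hWdef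
  by_contra hgt
  push Not at hgt
  obtain ⟨y₁, hy₁, y₂, hy₂, y₃, hy₃, h12', h23⟩ := exists_three_lt_of_card (T := W.roots.toFinset.filter (fun t => u < t ∧ t < v)) hgt
  by_cases hW0 : W = 0
  · rw [hW0, roots_zero, Multiset.toFinset_zero, Finset.filter_empty] at hy₁; exact absurd hy₁ (Finset.notMem_empty _)
  have hm : 0 < m := by
    rcases Nat.eq_zero_or_pos m with h0 | hpos
    · subst h0
      exact absurd (by rw [hWdef]; simp) hW0
    · exact hpos
  rw [mem_filter, Multiset.mem_toFinset, mem_roots hW0] at hy₁ hy₂ hy₃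
  refine wronskianK_no_three_zeros_of_rowLaws hm d hd a hu hlaws (x₁ := y₁) (x₂ := y₂) (x₃ := y₃) hy₁.2 hy₃.2 h12' h23 ?_
  intro x hx
  simp only [Set.mem_insert_iff, Set.mem_singleton_iff] at hx
  rcases hx with h | h | h <;> subst h
  · exact hy₁.1
  · exact hy₂.1
  · exact hy₃.1

/-! ### §2 The row laws of the menu classes -/

/-- **ROW LAW, two-letter tail without the bottom letter** (binomial on the pair `(d_{i+1}, d_{j+1})`, `i < j`): POLE (`a_i a_j < 0`, rate `≥ p`, root outside
`(u,v)`) or KNEE (`a_i a_j > 0`, rate `≤ p`) ⇒ on `(u,v)` the stripped row is non-zero and `p²ψ₁ < ψ₃`. [this file's theorem] -/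
theorem rowLaws_pair {n : ℕ} (d : Fin (n + 2) → ℕ) (hd : StrictMono d) (b : Fin (n + 2) → ℝ) {u v : ℝ} (hu : 0 < u)
    (i j : Fin (n + 1)) (hij : i < j) (hb0 : b 0 = 0) (hzero : ∀ l : Fin (n + 1), l ≠ i → l ≠ j → b l.succ = 0)
    (hj : b j.succ ≠ 0)
    (hkind : (b i.succ * b j.succ < 0 ∧ d 1 - d 0 ≤ d j.succ - d i.succ ∧
        0 ≤ (∑ l, C (b l) * X ^ (d l) : ℝ[X]).eval u * (∑ l, C (b l) * X ^ (d l) : ℝ[X]).eval v) ∨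
      (0 < b i.succ * b j.succ ∧ d j.succ - d i.succ ≤ d 1 - d 0))
    {x : ℝ} (hx : x ∈ Ioo u v) :
    b 0 - ∑ l : Fin (n + 1), (-(b l.succ)) * x ^ (d l.succ - d 0) ≠ 0 ∧
    ((d 1 - d 0 : ℕ) : ℝ) ^ 2 * rowPsiK1 (fun l : Fin (n + 1) => d l.succ - d 0) (b 0) (fun l : Fin (n + 1) => -(b l.succ)) x
      < rowPsiK3 (fun l : Fin (n + 1) => d l.succ - d 0) (b 0) (fun l : Fin (n + 1) => -(b l.succ)) x := by
  have hd0 : ∀ l, d 0 ≤ d l := fun l => hd.monotone (Fin.zero_le l)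
  have hx0 : 0 < x := hu.trans hx.1
  have hv : 0 < v := hu.trans (hx.1.trans hx.2)
  have hij' : (i : Fin (n + 1)) ≠ j := ne_of_lt hij
  have hdij : d i.succ < d j.succ := hd (Fin.succ_lt_succ_iff.2 hij)
  set lam : Fin (n + 1) → ℕ := fun l => d l.succ - d 0 with hlam
  have hB : ∀ l, l ≠ i → l ≠ j → (fun l : Fin (n + 1) => -(b l.succ)) l = 0 := fun l h1 h2 => by simp [hzero l h1 h2]
  have hμ : lam j - lam i = d j.succ - d i.succ := by
    show (d j.succ - d 0) - (d i.succ - d 0) = d j.succ - d i.succ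
    have := hd0 i.succ; omega
  have hμpos : lam i < lam j := by
    show d i.succ - d 0 < d j.succ - d 0
    have := hd0 i.succ; omega
  have hμne : lam i ≠ lam j := ne_of_lt hμpos
  have hcastμ : (((lam j : ℕ) : ℝ) - ((lam i : ℕ) : ℝ)) = ((d j.succ - d i.succ : ℕ) : ℝ) := by
    rw [← hμ, Nat.cast_sub hμpos.le]
  -- the stripped row: `0 − (−b_i)x^{λ_i} − (−b_j)x^{λ_j} = x^{λ_i}·(b_i + b_j x^{λ_j − λ_i})`
  have hrow : b 0 - ∑ l : Fin (n + 1), (-(b l.succ)) * x ^ (lam l) = x ^ (lam i) * (b i.succ + b j.succ * x ^ (lam j - lam i)) := by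
    rw [hb0, row_pair lam 0 (fun l : Fin (n + 1) => -(b l.succ)) i j hij' hB]
    have : x ^ (lam j) = x ^ (lam i) * x ^ (lam j - lam i) := by rw [← pow_add, Nat.add_sub_cancel' hμpos.le]
    rw [this]; ring
  have hevw : ∀ w, (∑ l, C (b l) * X ^ (d l) : ℝ[X]).eval w
      = w ^ (d 0) * (w ^ (lam i) * (b i.succ + b j.succ * w ^ (lam j - lam i))) := by
    intro w
    rw [eval_rowK_eq d hd0 b w, hb0, row_pair lam 0 (fun l : Fin (n + 1) => -(b l.succ)) i j hij' hB]
    have : w ^ (lam j) = w ^ (lam i) * w ^ (lam j - lam i) := by rw [← pow_add, Nat.add_sub_cancel' hμpos.le]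
    rw [this]; ring
  -- non-vanishing of the two-letter binomial on the window
  have hne : b i.succ + b j.succ * x ^ (lam j - lam i) ≠ 0 := by
    rcases hkind with ⟨hneg, -, hend⟩ | ⟨hpos, -⟩
    · have hend' : 0 ≤ (b i.succ + b j.succ * u ^ (lam j - lam i)) * (b i.succ + b j.succ * v ^ (lam j - lam i)) := by
        rw [hevw, hevw] at hend
        have hpw : 0 < (u ^ (d 0) * u ^ (lam i)) * (v ^ (d 0) * v ^ (lam i)) := by positivity
        have : u ^ (d 0) * (u ^ (lam i) * (b i.succ + b j.succ * u ^ (lam j - lam i)))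
            * (v ^ (d 0) * (v ^ (lam i) * (b i.succ + b j.succ * v ^ (lam j - lam i))))
            = ((u ^ (d 0) * u ^ (lam i)) * (v ^ (d 0) * v ^ (lam i)))
              * ((b i.succ + b j.succ * u ^ (lam j - lam i)) * (b i.succ + b j.succ * v ^ (lam j - lam i))) := by ring
        rw [this] at hend
        exact (mul_nonneg_iff_of_pos_left hpw).1 hend
      exact binomial_ne_zero_of_endpoints (b i.succ) (b j.succ) (by have := hμpos; omega) hu hx hend' hj
    · intro h
      have h' : b i.succ * b i.succ + b i.succ * b j.succ * x ^ (lam j - lam i) = 0 := by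
        have : b i.succ * (b i.succ + b j.succ * x ^ (lam j - lam i)) = 0 := by rw [h, mul_zero]
        linarith [this]
      nlinarith [mul_self_nonneg (b i.succ), mul_pos hpos (pow_pos hx0 (lam j - lam i))]
  have hF : b 0 - ∑ l : Fin (n + 1), (-(b l.succ)) * x ^ (lam l) ≠ 0 := by
    rw [hrow]; exact mul_ne_zero (pow_ne_zero _ hx0.ne') hne
  have hF0 : (0 : ℝ) - ∑ l : Fin (n + 1), (-(b l.succ)) * x ^ (lam l) ≠ 0 := by rwa [hb0] at hF
  refine ⟨hF, ?_⟩
  rw [hb0]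
  have hlaw := rowPsiK3_pair_law lam (fun l : Fin (n + 1) => -(b l.succ)) i j hij' hB hF0
  rw [hcastμ] at hlaw
  have hp0 : (0 : ℝ) ≤ ((d 1 - d 0 : ℕ) : ℝ) := Nat.cast_nonneg _
  have hq0 : (0 : ℝ) ≤ ((d j.succ - d i.succ : ℕ) : ℝ) := Nat.cast_nonneg _
  rcases hkind with ⟨hneg, hrate, -⟩ | ⟨hpos, hrate⟩
  · -- pole: `ψ₁ > 0`, rate `≥ p`
    have hBB : (fun l : Fin (n + 1) => -(b l.succ)) i * (fun l : Fin (n + 1) => -(b l.succ)) j < 0 := by simp only; nlinarith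
    have hψ := rowPsiK1_pair_pos lam (fun l : Fin (n + 1) => -(b l.succ)) i j hij' hB hx0 hμne hBB hF0
    have hpq : ((d 1 - d 0 : ℕ) : ℝ) ≤ ((d j.succ - d i.succ : ℕ) : ℝ) := by exact_mod_cast hrate
    have hpq2 : ((d 1 - d 0 : ℕ) : ℝ) ^ 2 ≤ ((d j.succ - d i.succ : ℕ) : ℝ) ^ 2 := by nlinarith
    have hsq : 0 < rowPsiK1 lam 0 (fun l : Fin (n + 1) => -(b l.succ)) x ^ 2 := by positivity
    nlinarith
  · -- knee: `ψ₁ < 0`, rate `≤ p`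
    have hBB : 0 < (fun l : Fin (n + 1) => -(b l.succ)) i * (fun l : Fin (n + 1) => -(b l.succ)) j := by simp only; nlinarith
    have hψ := rowPsiK1_pair_neg lam (fun l : Fin (n + 1) => -(b l.succ)) i j hij' hB hx0 hμne hBB hF0
    have hpq : ((d j.succ - d i.succ : ℕ) : ℝ) ≤ ((d 1 - d 0 : ℕ) : ℝ) := by exact_mod_cast hrate
    have hpq2 : ((d j.succ - d i.succ : ℕ) : ℝ) ^ 2 ≤ ((d 1 - d 0 : ℕ) : ℝ) ^ 2 := by nlinarith
    have hψne : rowPsiK1 lam 0 (fun l : Fin (n + 1) => -(b l.succ)) x ≠ 0 := hψ.ne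
    have hsq : 0 < rowPsiK1 lam 0 (fun l : Fin (n + 1) => -(b l.succ)) x ^ 2 := by positivity
    nlinarith

/-- **ROW LAW, one tail letter** (binomial on `(d₀, d_{l₀+1})`: any signs on the slow pair `l₀ = 0`, a POLE `b₀·b_{l₀+1} < 0` otherwise; root outside `(u,v)`):
on `(u,v)` the stripped row is non-zero and `p²ψ₁ < ψ₃`. [this file's theorem] -/
theorem rowLaws_single {n : ℕ} (d : Fin (n + 2) → ℕ) (hd : StrictMono d) (b : Fin (n + 2) → ℝ) {u v : ℝ} (hu : 0 < u)
    (l₀ : Fin (n + 1)) (hzero : ∀ l : Fin (n + 1), l ≠ l₀ → b l.succ = 0) (h0 : b 0 ≠ 0) (hl0 : b l₀.succ ≠ 0)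
    (hkind : l₀ = 0 ∨ b 0 * b l₀.succ < 0)
    (hend : 0 ≤ (∑ l, C (b l) * X ^ (d l) : ℝ[X]).eval u * (∑ l, C (b l) * X ^ (d l) : ℝ[X]).eval v)
    {x : ℝ} (hx : x ∈ Ioo u v) :
    b 0 - ∑ l : Fin (n + 1), (-(b l.succ)) * x ^ (d l.succ - d 0) ≠ 0 ∧
    ((d 1 - d 0 : ℕ) : ℝ) ^ 2 * rowPsiK1 (fun l : Fin (n + 1) => d l.succ - d 0) (b 0) (fun l : Fin (n + 1) => -(b l.succ)) x
      < rowPsiK3 (fun l : Fin (n + 1) => d l.succ - d 0) (b 0) (fun l : Fin (n + 1) => -(b l.succ)) x := by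
  have hd0 : ∀ l, d 0 ≤ d l := fun l => hd.monotone (Fin.zero_le l)
  have hx0 : 0 < x := hu.trans hx.1
  have hv : 0 < v := hu.trans (hx.1.trans hx.2)
  set lam : Fin (n + 1) → ℕ := fun l => d l.succ - d 0 with hlam
  have hlam_ge : ∀ l : Fin (n + 1), d 1 - d 0 ≤ lam l := by
    intro l
    have : d 1 ≤ d l.succ := hd.monotone (by
      change (1 : Fin (n + 2)) ≤ l.succ
      rw [Fin.le_def]
      simp)
    show d 1 - d 0 ≤ d l.succ - d 0
    omega
  have hp1 : 1 ≤ d 1 - d 0 := by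
    have := hd (show (0 : Fin (n + 2)) < 1 from Fin.zero_lt_one)
    omega
  have hlam_ne : ∀ l : Fin (n + 1), lam l ≠ 0 := fun l => by have := hlam_ge l; omega
  have hB : ∀ l, l ≠ l₀ → (fun l : Fin (n + 1) => -(b l.succ)) l = 0 := fun l hl => by simp [hzero l hl]
  have hrs := row_single lam (b 0) (fun l : Fin (n + 1) => -(b l.succ)) l₀ hB
  have hevw : ∀ w, (∑ l, C (b l) * X ^ (d l) : ℝ[X]).eval w = w ^ (d 0) * (b 0 + b l₀.succ * w ^ (lam l₀)) := by
    intro w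
    rw [eval_rowK_eq d hd0 b w, row_single lam (b 0) (fun l : Fin (n + 1) => -(b l.succ)) l₀ hB]; ring
  have hend' : 0 ≤ (b 0 + b l₀.succ * u ^ (lam l₀)) * (b 0 + b l₀.succ * v ^ (lam l₀)) := by
    rw [hevw, hevw] at hend
    have hpow : 0 < u ^ (d 0) * v ^ (d 0) := mul_pos (pow_pos hu _) (pow_pos hv _)
    have : u ^ (d 0) * (b 0 + b l₀.succ * u ^ (lam l₀)) * (v ^ (d 0) * (b 0 + b l₀.succ * v ^ (lam l₀)))
        = (u ^ (d 0) * v ^ (d 0)) * ((b 0 + b l₀.succ * u ^ (lam l₀)) * (b 0 + b l₀.succ * v ^ (lam l₀))) := by ring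
    rw [this] at hend
    exact (mul_nonneg_iff_of_pos_left hpow).1 hend
  have hne : b 0 + b l₀.succ * x ^ (lam l₀) ≠ 0 :=
    binomial_ne_zero_of_endpoints (b 0) (b l₀.succ) (hlam_ne l₀) hu hx hend' hl0
  have hF : b 0 - ∑ l : Fin (n + 1), (-(b l.succ)) * x ^ (lam l) ≠ 0 := by
    rw [hrs]
    have : b 0 - -(b l₀.succ) * x ^ (lam l₀) = b 0 + b l₀.succ * x ^ (lam l₀) := by ring
    rwa [this]
  refine ⟨hF, ?_⟩
  have hlaw := rowPsiK3_single_law lam (b 0) (fun l : Fin (n + 1) => -(b l.succ)) l₀ hB x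
  have hlam0 : ((d 1 - d 0 : ℕ) : ℝ) ≤ ((lam l₀ : ℕ) : ℝ) := by exact_mod_cast hlam_ge l₀
  have hp0 : (0 : ℝ) ≤ ((d 1 - d 0 : ℕ) : ℝ) := Nat.cast_nonneg _
  rcases hkind with hl00 | hpole
  · subst hl00
    have hlam00 : ((lam 0 : ℕ) : ℝ) = ((d 1 - d 0 : ℕ) : ℝ) := by
      show (((d (0 : Fin (n + 1)).succ - d 0 : ℕ)) : ℝ) = ((d 1 - d 0 : ℕ) : ℝ)
      rfl
    rw [hlam00] at hlaw
    have hψ : rowPsiK1 lam (b 0) (fun l : Fin (n + 1) => -(b l.succ)) x ≠ 0 := by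
      rcases lt_or_gt_of_ne (mul_ne_zero h0 (neg_ne_zero.2 hl0) : b 0 * -(b (0 : Fin (n + 1)).succ) ≠ 0) with hneg | hpos
      · exact (rowPsiK1_single_neg lam (b 0) (fun l : Fin (n + 1) => -(b l.succ)) 0 hB hx0 (hlam_ne 0) hneg hF).ne
      · exact (rowPsiK1_single_pos lam (b 0) (fun l : Fin (n + 1) => -(b l.succ)) 0 hB hx0 (hlam_ne 0) hpos hF).ne'
    have hsq : 0 < rowPsiK1 lam (b 0) (fun l : Fin (n + 1) => -(b l.succ)) x ^ 2 := by positivity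
    linarith
  · have hAB : 0 < b 0 * (fun l : Fin (n + 1) => -(b l.succ)) l₀ := by simp only; nlinarith
    have hψ : 0 < rowPsiK1 lam (b 0) (fun l : Fin (n + 1) => -(b l.succ)) x :=
      rowPsiK1_single_pos lam (b 0) (fun l : Fin (n + 1) => -(b l.succ)) l₀ hB hx0 (hlam_ne l₀) hAB hF
    have hsq : 0 < rowPsiK1 lam (b 0) (fun l : Fin (n + 1) => -(b l.succ)) x ^ 2 := by positivity
    have hpq : ((d 1 - d 0 : ℕ) : ℝ) ^ 2 ≤ ((lam l₀ : ℕ) : ℝ) ^ 2 := by nlinarith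
    nlinarith

/-- **ROW LAW, unswitched incoherent K-nomial** (`b₀ > 0`, all `b_{l+1} ≤ 0`, `Σ_l b_{l+1} < 0`, `f(v) > 0`): on `(u,v)` the stripped row is positive and
`p²ψ₁ < ψ₃` (✓ `rowPsiK3_gt`, no gap condition). [this file's theorem] -/
theorem rowLaws_cloud {n : ℕ} (d : Fin (n + 2) → ℕ) (hd : StrictMono d) (b : Fin (n + 2) → ℝ) {u v : ℝ} (hu : 0 < u)
    (hle : ∀ l : Fin (n + 1), b l.succ ≤ 0) (hsum : ∑ l : Fin (n + 1), b l.succ < 0)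
    (hvpos : 0 < (∑ l, C (b l) * X ^ (d l) : ℝ[X]).eval v)
    {x : ℝ} (hx : x ∈ Ioo u v) :
    b 0 - ∑ l : Fin (n + 1), (-(b l.succ)) * x ^ (d l.succ - d 0) ≠ 0 ∧
    ((d 1 - d 0 : ℕ) : ℝ) ^ 2 * rowPsiK1 (fun l : Fin (n + 1) => d l.succ - d 0) (b 0) (fun l : Fin (n + 1) => -(b l.succ)) x
      < rowPsiK3 (fun l : Fin (n + 1) => d l.succ - d 0) (b 0) (fun l : Fin (n + 1) => -(b l.succ)) x := by
  have hd0 : ∀ l, d 0 ≤ d l := fun l => hd.monotone (Fin.zero_le l)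
  have hx0 : 0 < x := hu.trans hx.1
  have hv : 0 < v := hu.trans (hx.1.trans hx.2)
  set lam : Fin (n + 1) → ℕ := fun l => d l.succ - d 0 with hlam
  have hlam_ge : ∀ l : Fin (n + 1), d 1 - d 0 ≤ lam l := by
    intro l
    have : d 1 ≤ d l.succ := hd.monotone (by
      change (1 : Fin (n + 2)) ≤ l.succ
      rw [Fin.le_def]
      simp)
    show d 1 - d 0 ≤ d l.succ - d 0
    omega
  have hp1 : 1 ≤ d 1 - d 0 := by
    have := hd (show (0 : Fin (n + 2)) < 1 from Fin.zero_lt_one)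
    omega
  have hlam_ne : ∀ l : Fin (n + 1), lam l ≠ 0 := fun l => by have := hlam_ge l; omega
  have hB0 : ∀ l, 0 ≤ (fun l : Fin (n + 1) => -(b l.succ)) l := fun l => by simp only; linarith [hle l]
  have hposg : 0 < b 0 - ∑ l : Fin (n + 1), (-(b l.succ)) * x ^ (lam l) := by
    rw [eval_rowK_eq d hd0 b v] at hvpos
    have h3 : 0 < b 0 - ∑ l : Fin (n + 1), (-(b l.succ)) * v ^ (lam l) := (mul_pos_iff_of_pos_left (pow_pos hv _)).1 hvpos
    have hmono : ∑ l : Fin (n + 1), (-(b l.succ)) * x ^ (lam l) ≤ ∑ l : Fin (n + 1), (-(b l.succ)) * v ^ (lam l) :=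
      Finset.sum_le_sum fun l _ => mul_le_mul_of_nonneg_left (pow_le_pow_left₀ hx0.le hx.2.le _) (hB0 l)
    linarith
  refine ⟨hposg.ne', ?_⟩
  have hH1 : 0 < rowHK lam 1 (fun l : Fin (n + 1) => -(b l.succ)) x := by
    obtain ⟨l₁, hl₁⟩ : ∃ l : Fin (n + 1), b l.succ < 0 := by
      by_contra hcon
      push Not at hcon
      have : ∑ l : Fin (n + 1), b l.succ = 0 := Finset.sum_eq_zero fun l _ => le_antisymm (hle l) (hcon l)
      linarith
    unfold rowHK
    refine Finset.sum_pos' (fun l _ => mul_nonneg (mul_nonneg (by positivity) (hB0 l)) (pow_pos hx0 _).le)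
      ⟨l₁, Finset.mem_univ _, ?_⟩
    have hl1 : (0 : ℝ) < ((lam l₁ : ℕ) : ℝ) := by exact_mod_cast Nat.pos_of_ne_zero (hlam_ne l₁)
    simp only [pow_one]
    exact mul_pos (mul_pos hl1 (by linarith)) (pow_pos hx0 _)
  exact rowPsiK3_gt lam (b 0) (fun l : Fin (n + 1) => -(b l.succ)) (d 1 - d 0) hx0 hB0 hlam_ge hposg hH1

end ProductPlusOne

end Summit.ValiantsHypothesis.ValiantsHypothesis.Theorems.LacunarySymmetroidMatrixDescartes
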